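import Literature.Topology.Immersions.NormalProjBundle
import Literature.Topology.Immersions.ProjBundleIso
import Literature.Topology.Immersions.ProjBundleBasic
import Literature.Topology.Immersions.DoublePointsGenericity
import Mathlib.Analysis.InnerProductSpace.Projection.FiniteDimensional
import HarnessLib

/-!
# The normal bundle of the double-point immersion is the pull-back of the normal bundle

Topic `Literature/Topology/Immersions`. Kirby, *The Topology of 4-Manifolds* (1989), Ch. VI,
proof of Lemma 4 (p. 40): for a self-transverse immersion `f : M⁴ → R⁶` with double-point surface
`Δ`, *"the normal bundle of `Δ` in `M` … is the pullback of `ν`"* — the identity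
`e(ν_Δ)[Δ] = e(ν)[Δ]` used in `3 ♯M = e(ν)²[M]`. General form: for an immersion
`f : M → ℝ^q` (`dim M = n`, `k + n = q`) and the double-point manifold `Z` with its two sheet
maps `π₁, π₂ : Z → M` (`DoublePointManifold.lean`: `f ∘ π₁ = f ∘ π₂`, immersions, and the tangent
characterisation `df_{π₁ z} ξ = df_{π₂ z} η ↔ (ξ, η) = (dπ₁ u, dπ₂ u)`), the normal bundle of the
immersion `π₁ : Z → M`, realised in `ℝ^q` as the bundle of rank `k = n - dim Z` with fibre

  `ν_{Δ,z} = df_x(T_x M) ⊖ d(f ∘ π₁)_z(T_z Z)`,  `x = π₁ z`,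

(`doublePointNormal`, projection field `P^{tan}_{f}(π₁ z) - P^{tan}_{f ∘ π₁}(z)`) is ISOMORPHIC
(`ProjBundle.IsIso`, `ProjBundleIso.lean`) to the pull-back `π₂^* ν_f` of the normal bundle of
`f` along the OTHER sheet, through `v ↦ (1 - P^{tan}_f(π₂ z)) v`
(`isIso_doublePointNormal_pullback_normal`): a vector of `ν_{Δ,z}` killed by the normal
projection of the second sheet is tangent to both sheets, hence tangent to `Δ`, hence zero.

Everything here is proved; the definition `doublePointNormal` is data; no named facts.

## References

* R. C. Kirby, *The Topology of 4-Manifolds*, LNM 1374 (1989), Ch. VI, proof of Lemma 4, p. 40.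
  [Kirby1989]
* J. Milnor, J. Stasheff, *Characteristic Classes* (1974), §3 (normal bundles), §11.
  [MilnorStasheff1974]
-/

open scoped Manifold ContDiff Topology RealInnerProductSpace
open Set Function Module

noncomputable section

namespace Literature.Topology.Immersions

/-- Local notation: `𝔼 n` is the model Euclidean space `EuclideanSpace ℝ (Fin n)`. -/
local notation "𝔼 " n:arg => EuclideanSpace ℝ (Fin n)

open Literature.Topology.FourManifolds (tangentPlane tangentProj normalSpace contMDiff_tangentProj
  tangentProj_apply_of_mem tangentProj_apply_mem mfderiv_mem_tangentPlane mem_tangentPlane_iff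
  tangentProj_apply_eq_zero_iff)

variable {n q k d : ℕ} {M : Type*} [TopologicalSpace M] [ChartedSpace (𝔼 n) M]
  [IsManifold (𝓡 n) ∞ M] {Z : Type*} [TopologicalSpace Z] [ChartedSpace (𝔼 d) Z]
  [IsManifold (𝓡 d) ∞ Z]

/-! ### Nested orthogonal projections -/

section Nested

variable {V : Type*} [NormedAddCommGroup V] [InnerProductSpace ℝ V] [FiniteDimensional ℝ V]

/-- For nested subspaces `U ≤ W`, `P_W ∘ P_U = P_U`. [folklore] -/
theorem starProjection_comp_of_le {U W : Submodule ℝ V} (h : U ≤ W) (v : V) :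
    W.starProjection (U.starProjection v) = U.starProjection v :=
  Submodule.starProjection_eq_self_iff.2 (h (Submodule.starProjection_apply_mem U v))

/-- For nested subspaces `U ≤ W`, `P_U ∘ P_W = P_U`. [folklore] -/
theorem starProjection_comp_of_le' {U W : Submodule ℝ V} (h : U ≤ W) (v : V) :
    U.starProjection (W.starProjection v) = U.starProjection v := by
  -- `v - P_W v ⊥ W ⊇ U`
  have hv : v - W.starProjection v ∈ Uᗮ :=
    Submodule.orthogonal_le h (Submodule.sub_starProjection_mem_orthogonal v)
  have h0 : U.starProjection (v - W.starProjection v) = 0 :=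
    (Submodule.starProjection_apply_eq_zero_iff U).2 hv
  rw [map_sub, sub_eq_zero] at h0
  exact h0.symm

/-- For nested subspaces `U ≤ W`, the range of `P_W - P_U` is `W ⊓ Uᗮ`. [folklore] -/
theorem range_starProjection_sub_of_le {U W : Submodule ℝ V} (h : U ≤ W) :
    LinearMap.range (W.starProjection - U.starProjection).toLinearMap = W ⊓ Uᗮ := by
  apply le_antisymm
  · rintro _ ⟨v, rfl⟩
    have hW : W.starProjection v - U.starProjection v ∈ W :=
      Submodule.sub_mem _ (Submodule.starProjection_apply_mem W v)
        (h (Submodule.starProjection_apply_mem U v))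
    have hU : W.starProjection v - U.starProjection v ∈ Uᗮ := by
      rw [Submodule.mem_orthogonal']
      intro u hu
      rw [inner_sub_left, Submodule.inner_starProjection_left_eq_right,
      Submodule.inner_starProjection_left_eq_right,
        Submodule.starProjection_eq_self_iff.2 (h hu), Submodule.starProjection_eq_self_iff.2 hu,
        sub_self]
    exact ⟨hW, hU⟩
  · rintro w ⟨hwW, hwU⟩
    refine ⟨w, ?_⟩
    show W.starProjection w - U.starProjection w = w
    rw [Submodule.starProjection_eq_self_iff.2 hwW, (Submodule.starProjection_apply_eq_zero_iff U).2 hwU,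
      sub_zero]

end Nested

/-! ### The normal bundle of the double-point immersion -/

section DoublePoint

variable (hk : k + n = q) (hd : d + k = n) {f : M → 𝔼 q} (hf : ContMDiff (𝓡 n) (𝓡 q) ∞ f)
  (himm : ∀ x, Injective (mfderiv (𝓡 n) (𝓡 q) f x)) {π₁ : Z → M}
  (hπ₁ : ContMDiff (𝓡 d) (𝓡 n) ∞ π₁) (hπ₁i : ∀ z, Injective (mfderiv (𝓡 d) (𝓡 n) π₁ z))

omit [IsManifold (𝓡 n) ∞ M] [IsManifold (𝓡 d) ∞ Z] in
include hf himm hπ₁ hπ₁i in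
/-- The first sheet `f ∘ π₁ : Z → ℝ^q` is an immersion. [folklore] -/
theorem injective_mfderiv_comp_sheet (z : Z) :
    Injective (mfderiv (𝓡 d) (𝓡 q) (f ∘ π₁) z) := by
  rw [mfderiv_comp z ((hf _).mdifferentiableAt (by simp)) ((hπ₁ z).mdifferentiableAt (by simp))]
  exact (himm _).comp (hπ₁i z)

omit [IsManifold (𝓡 n) ∞ M] [IsManifold (𝓡 d) ∞ Z] in
include hf hπ₁ in
/-- The tangent plane of the sheet lies in the tangent plane of `f`. [folklore] -/
theorem tangentPlane_comp_sheet_le (z : Z) :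
    tangentPlane (𝓡 d) (f ∘ π₁) z ≤ tangentPlane (𝓡 n) f (π₁ z) := by
  intro v hv
  obtain ⟨u, rfl⟩ := (mem_tangentPlane_iff (I := 𝓡 d)).1 hv
  rw [mfderiv_comp z ((hf _).mdifferentiableAt (by simp)) ((hπ₁ z).mdifferentiableAt (by simp))]
  exact mfderiv_mem_tangentPlane (I := 𝓡 n) f (π₁ z) _

/-- **The normal bundle `ν_Δ` of the double-point immersion `π₁ : Z → M`, realised in `ℝ^q`**:
the bundle of rank `k` over `Z` with fibre `df_x(T_x M) ⊖ d(f ∘ π₁)_z(T_z Z)` (`x = π₁ z`).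
[cite: Kirby1989, Ch. VI proof of Lemma 4] -/
def doublePointNormal : ProjBundle d q k Z where
  proj z := tangentProj (𝓡 n) f (π₁ z) - tangentProj (𝓡 d) (f ∘ π₁) z
  contMDiff_proj' := ((contMDiff_tangentProj (I := 𝓡 n) hf himm).comp hπ₁).sub
    (contMDiff_tangentProj (I := 𝓡 d) (hf.comp hπ₁) (injective_mfderiv_comp_sheet hf himm hπ₁ hπ₁i))
  proj_proj z v := by
    have hle := tangentPlane_comp_sheet_le hf hπ₁ z
    show tangentProj (𝓡 n) f (π₁ z) (tangentProj (𝓡 n) f (π₁ z) v - tangentProj (𝓡 d) (f ∘ π₁) z v) -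
        tangentProj (𝓡 d) (f ∘ π₁) z (tangentProj (𝓡 n) f (π₁ z) v - tangentProj (𝓡 d) (f ∘ π₁) z v) =
      tangentProj (𝓡 n) f (π₁ z) v - tangentProj (𝓡 d) (f ∘ π₁) z v
    simp only [map_sub, tangentProj]
    rw [Submodule.starProjection_eq_self_iff.2 (Submodule.starProjection_apply_mem _ v),
      starProjection_comp_of_le hle, starProjection_comp_of_le' hle,
      Submodule.starProjection_eq_self_iff.2 (Submodule.starProjection_apply_mem _ v)]
    abel
  inner_proj_comm z v w := by
    show ⟪tangentProj (𝓡 n) f (π₁ z) v - tangentProj (𝓡 d) (f ∘ π₁) z v, w⟫ =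
      ⟪v, tangentProj (𝓡 n) f (π₁ z) w - tangentProj (𝓡 d) (f ∘ π₁) z w⟫
    simp only [tangentProj, inner_sub_left, inner_sub_right,
      Submodule.inner_starProjection_left_eq_right]
  finrank_range z := by
    have hle := tangentPlane_comp_sheet_le hf hπ₁ z
    have hr : LinearMap.range (tangentProj (𝓡 n) f (π₁ z) - tangentProj (𝓡 d) (f ∘ π₁) z).toLinearMap =
        tangentPlane (𝓡 n) f (π₁ z) ⊓ (tangentPlane (𝓡 d) (f ∘ π₁) z)ᗮ :=
      range_starProjection_sub_of_le hle
    rw [hr, inf_comm]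
    apply Submodule.finrank_add_inf_finrank_orthogonal' hle
    have h1 : finrank ℝ (tangentPlane (𝓡 d) (f ∘ π₁) z) = d := by
      change finrank ℝ (LinearMap.range (mfderiv (𝓡 d) (𝓡 q) (f ∘ π₁) z).toLinearMap) = d
      rw [LinearMap.finrank_range_of_inj (injective_mfderiv_comp_sheet hf himm hπ₁ hπ₁i z)]
      exact finrank_euclideanSpace_fin
    have h2 : finrank ℝ (tangentPlane (𝓡 n) f (π₁ z)) = n := by
      change finrank ℝ (LinearMap.range (mfderiv (𝓡 n) (𝓡 q) f (π₁ z)).toLinearMap) = n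
      rw [LinearMap.finrank_range_of_inj (himm _)]
      exact finrank_euclideanSpace_fin
    rw [h1, h2]
    omega

/-- The projections of `ν_Δ`. [folklore] -/
theorem doublePointNormal_proj (z : Z) :
    (doublePointNormal hd hf himm hπ₁ hπ₁i).proj z =
      tangentProj (𝓡 n) f (π₁ z) - tangentProj (𝓡 d) (f ∘ π₁) z := rfl

/-- **The fibre of `ν_Δ` at `z`** is `df_x(T_x M) ⊓ (d(f ∘ π₁)(T_z Z))ᗮ`. [cite: Kirby1989, Ch. VI proof of Lemma 4] -/
theorem fibre_doublePointNormal (z : Z) :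
    (doublePointNormal hd hf himm hπ₁ hπ₁i).fibre z =
      tangentPlane (𝓡 n) f (π₁ z) ⊓ (tangentPlane (𝓡 d) (f ∘ π₁) z)ᗮ :=
  range_starProjection_sub_of_le (tangentPlane_comp_sheet_le hf hπ₁ z)

/-- **`ν_Δ ≅ π₂^* ν_f`**: the normal projection of the second sheet is an isomorphism from the
normal bundle of the double-point immersion onto the pull-back of the normal bundle of `f` along
the other sheet. [cite: Kirby1989, Ch. VI proof of Lemma 4, p. 40] -/
theorem isIso_doublePointNormal_pullback_normal {π₂ : Z → M} (hπ₂ : ContMDiff (𝓡 d) (𝓡 n) ∞ π₂)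
    (htan : ∀ (z : Z) (ζ : 𝔼 n × 𝔼 n), ediff n q f (π₁ z) ζ.1 = ediff n q f (π₂ z) ζ.2 →
      ∃ u : 𝔼 d, (mfderiv (𝓡 d) (𝓡 n) π₁ z u, mfderiv (𝓡 d) (𝓡 n) π₂ z u) = ζ) :
    ProjBundle.IsIso (doublePointNormal hd hf himm hπ₁ hπ₁i)
      ((ProjBundle.normal hk f hf himm).pullback π₂ hπ₂) fun z => ProjBundle.normalProj n f (π₂ z) := by
  refine ⟨⟨?_, fun z v _ => ?_⟩, fun z => ?_⟩
  · exact (ProjBundle.normal hk f hf himm).contMDiff_proj'.comp hπ₂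
  · exact (ProjBundle.normal hk f hf himm).proj_mem_fibre (π₂ z) v
  · -- injectivity on the fibre
    intro v hv w hw hvw
    rw [fibre_doublePointNormal] at hv hw
    have hsub : v - w ∈ tangentPlane (𝓡 n) f (π₁ z) ⊓ (tangentPlane (𝓡 d) (f ∘ π₁) z)ᗮ :=
      Submodule.sub_mem _ hv hw
    -- `(1 - P^{tan}_y)(v - w) = 0`: `v - w` is tangent to the second sheet
    have h0 : ProjBundle.normalProj n f (π₂ z) (v - w) = 0 := by rw [map_sub, hvw, sub_self]
    rw [ProjBundle.normalProj_apply, sub_eq_zero] at h0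
    have hy : v - w ∈ tangentPlane (𝓡 n) f (π₂ z) := h0 ▸ tangentProj_apply_mem (I := 𝓡 n) f (π₂ z) _
    -- tangent to both sheets: `v - w = df_x ξ = df_y η`, so `(ξ, η) = (dπ₁ u, dπ₂ u)`
    obtain ⟨ξ, hξ⟩ : ∃ ξ : 𝔼 n, mfderiv (𝓡 n) (𝓡 q) f (π₁ z) ξ = v - w :=
      (mem_tangentPlane_iff (I := 𝓡 n)).1 hsub.1
    obtain ⟨η, hη⟩ : ∃ η : 𝔼 n, mfderiv (𝓡 n) (𝓡 q) f (π₂ z) η = v - w :=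
      (mem_tangentPlane_iff (I := 𝓡 n)).1 hy
    obtain ⟨u, hu⟩ := htan z (ξ, η) (by
      show mfderiv (𝓡 n) (𝓡 q) f (π₁ z) ξ = mfderiv (𝓡 n) (𝓡 q) f (π₂ z) η
      rw [hξ, hη])
    have hu₁ : mfderiv (𝓡 d) (𝓡 n) π₁ z u = ξ := congrArg Prod.fst hu
    -- hence `v - w = d(f ∘ π₁) u` lies in the sheet's tangent plane, and is orthogonal to it
    have hmem : v - w ∈ tangentPlane (𝓡 d) (f ∘ π₁) z := by
      rw [← hξ, ← hu₁]
      have hc := mfderiv_comp z (g := f) (f := π₁) ((hf _).mdifferentiableAt (by simp))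
        ((hπ₁ z).mdifferentiableAt (by simp))
      have : mfderiv (𝓡 n) (𝓡 q) f (π₁ z) (mfderiv (𝓡 d) (𝓡 n) π₁ z u) =
          mfderiv (𝓡 d) (𝓡 q) (f ∘ π₁) z u := by rw [hc]; rfl
      rw [this]
      exact mfderiv_mem_tangentPlane (I := 𝓡 d) (f ∘ π₁) z u
    have hzero : v - w = 0 := by
      have h := Submodule.inner_right_of_mem_orthogonal hmem hsub.2
      exact inner_self_eq_zero.1 h
    exact sub_eq_zero.1 hzero

end DoublePoint

end Literature.Topology.Immersions
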